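import Literature.AlgebraicGeometry.HodgeTheory.AffineCoverDolbeaultLeray
import HarnessLib

/-!
# The analytic model underlying a Hodge model

[topic AlgebraicGeometry/HodgeTheory]
* [SerreGAGA1956] J.-P. Serre, GAGA, Ann. Inst. Fourier 6 (1956), §2 (the analytification `X^an → X(ℂ)`).
* [HormanderSCV1973] L. Hörmander, *An Introduction to Complex Analysis in Several Variables*, Cor. 5.2.6,
  Thm. 7.4.1.

A `HodgeModel n X` (`RationalHodgeClasses.lean`: analytification `ψ : carrier → X(ℂ)` charted on
`model`, plus a natural de Rham comparison family and the Hodge decomposition) FORGETS to an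
`AnalyticModel model n X` (`AbsoluteHodgeClasses.lean`: the analytification alone — "`HodgeModel`
without the de Rham family and the Hodge decomposition"). The projection `HodgeModel.toAnalyticModel`
(definitionally the same carrier, charts and comparison map) lets every theorem stated for analytic
models — Cartan's Theorem B in Dolbeault form on smooth affine varieties and their affine open pieces
(`AnalyticModel.subsingleton_dolbeaultCohomology`, `…_openSet`), the Leray comparison for affine covers
(`AnalyticModel.nonempty_cechDolbeaultEquiv`), Runge approximation — be applied to the Hodge models
used on the Summit side. Recorded instances: `HodgeModel.subsingleton_dolbeaultCohomology` (smooth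
affine base) and `HodgeModel.subsingleton_dolbeaultCohomology_openSet` (affine open piece of a smooth `X`).

One definition (a projection, no new notion), theorems otherwise; no named facts.
-/

noncomputable section

open scoped Manifold ContDiff Topology
open CategoryTheory AlgebraicGeometry Set Function
open Literature.Analysis.Complex Literature.NumberTheory.Transcendental
open Literature.AlgebraicGeometry.Motives Literature.Geometry.Kaehler

namespace Literature.AlgebraicGeometry.HodgeTheory

variable {n : ℕ} {X : Motives.SchemeOver ℂ}

/-- **The analytic model underlying a Hodge model**: same carrier `X^an`, same holomorphic atlas on
`A.model`, same comparison map `ψ : X^an → X(ℂ)`; the de Rham family and the Hodge decomposition are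
forgotten. [cite: SerreGAGA1956, §2] -/
def HodgeModel.toAnalyticModel (A : HodgeModel n X) : AnalyticModel A.model n X where
  carrier := A.carrier
  toComplexPoints := A.toComplexPoints
  isAnalytification := A.isAnalytification

/-- The carrier is unchanged. [cite: SerreGAGA1956, §2] -/
@[simp] theorem HodgeModel.toAnalyticModel_carrier (A : HodgeModel n X) :
    A.toAnalyticModel.carrier = A.carrier := rfl

/-- The comparison map is unchanged. [cite: SerreGAGA1956, §2] -/
@[simp] theorem HodgeModel.toAnalyticModel_toComplexPoints (A : HodgeModel n X) :
    A.toAnalyticModel.toComplexPoints = A.toComplexPoints := rfl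

/-- The analytification datum is unchanged. [cite: SerreGAGA1956, §2] -/
theorem HodgeModel.toAnalyticModel_isAnalytification (A : HodgeModel n X) :
    A.toAnalyticModel.isAnalytification = A.isAnalytification := rfl

/-- Regular functions read on the underlying analytic model are `s ∘ ψ` (total value).
[cite: SerreGAGA1956, §2] -/
theorem HodgeModel.toAnalyticModel_regularFun (A : HodgeModel n X) (s : Γ(X.left, ⊤)) (x : A.carrier) :
    A.toAnalyticModel.regularFun s x = AlgPoints.evalOrZero ⊤ s (A.toComplexPoints x) := rfl

/-- The open piece of the underlying analytic model over an open `O ⊆ X` is `ψ⁻¹(O(ℂ))`.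
[cite: SerreGAGA1956, §2] -/
theorem HodgeModel.mem_toAnalyticModel_openSet (A : HodgeModel n X) (O : X.left.Opens) (x : A.carrier) :
    x ∈ A.toAnalyticModel.openSet O ↔ (A.toComplexPoints x).pt ∈ O :=
  Iff.rfl

/-- **Cartan's Theorem B in Dolbeault form on a Hodge model of a smooth affine variety**:
`H^{p,q+1}_{∂̄}(X^an) = 0` (`AnalyticModel.subsingleton_dolbeaultCohomology` through the projection).
[cite: HormanderSCV1973, Cor. 5.2.6] -/
theorem HodgeModel.subsingleton_dolbeaultCohomology [IsAffine X.left] [SmoothOfRelativeDimension n X.hom]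
    (A : HodgeModel n X) (p q : ℕ) :
    Subsingleton (dolbeaultCohomology A.model A.carrier p (q + 1)) :=
  A.toAnalyticModel.subsingleton_dolbeaultCohomology p q

/-- **Theorem B on the affine open pieces of a Hodge model**: for `X` smooth (of relative dimension
`n`) and an affine open `O ⊆ X`, the open submanifold `ψ⁻¹(O(ℂ)) ⊆ X^an` has
`H^{p,q+1}_{∂̄} = 0` (`AnalyticModel.subsingleton_dolbeaultCohomology_openSet`).
[cite: HormanderSCV1973, Cor. 5.2.6] -/
theorem HodgeModel.subsingleton_dolbeaultCohomology_openSet [SmoothOfRelativeDimension n X.hom]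
    (A : HodgeModel n X) {O : X.left.Opens} (hO : IsAffineOpen O) (p q : ℕ) :
    Subsingleton (dolbeaultCohomology A.model (A.toAnalyticModel.openSet O) p (q + 1)) :=
  A.toAnalyticModel.subsingleton_dolbeaultCohomology_openSet hO p q

end Literature.AlgebraicGeometry.HodgeTheory
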